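import Summits.CriticalPhenomena.PercolationContinuityZ3.Theorems.PercNearOneGluingNoHeavyLowerTailSahiCombTriWDisjointGen

/-!
# `TriWIneq` for ANY NUMBER of pairwise disjoint generators: `P = ↑g₁ ∪ … ∪ ↑g_k` (read-once monotone DNF with disjoint terms), all `n`, all `a`

Support file of the one-cut programme (crux `NoHeavyLowerTail`, stmt-CriticalPhenomena-4575; unit `prim-lf-1` gen 41, memo
`FROM-prim-lf-1-gen41-SHELLS-AND-OR-PRODUCTS.md`).  Iteration of the OR-product theorem (`…SahiCombTriWOrProduct`) along the blocks `g₁, g₂, …`: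
peel off one generator `g`, read the others inside the complement block `{a // a ∉ g}`, apply the induction hypothesis there (the statement is proved for
all finite ground types simultaneously, by induction on the number of generators), and glue with `klShell_orProd` + relabeling.

* `FiveUpSet.genUp gens = {t | ∃ g ∈ gens, g ⊆ t}`;
* `FiveUpSet.famMap_genUp_cons` — peeling identity `famMap (blockEquiv g) (genUp gens) = orProd (↑univ) (genUp gens')`, `gens'` = the other generators in the block `gᶜ`;
* **`FiveUpSet.klShell_genUp_disjoint`** — pairwise disjoint nonempty generators ⟹ the shell of `genUp gens` is a Kleitman shell;
* **`FiveUpSet.triW_nonneg_genUp_disjoint`** — ⟹ `0 ≤ triW (genUp gens) F G` for every index cube and all monotone families of up-sets (free coordinates allowed;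
  `gens = ∅` gives the empty family, one generator the principal stratum, two the file `…TriWDisjointGen`).
HONEST LABEL: complete proofs, std axioms; a new unconditional infinite stratum of `TriWIneq`; `TriWIneq` itself stays OPEN. [this work]
-/

namespace Summit.CriticalPhenomena.PercolationContinuityZ3.Theorems

namespace FiveUpSet

open Finset

variable {β γ : Type} [DecidableEq β] [Fintype β] [DecidableEq γ] [Fintype γ]

/-- The up-set generated by a set of generators: `{t | ∃ g ∈ gens, g ⊆ t}`. [this work] -/
def genUp (gens : Finset (Finset γ)) : Finset (Finset γ) := univ.filter fun t => ∃ g ∈ gens, g ⊆ t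

omit [DecidableEq β] [Fintype β] in
/-- Membership in `genUp`. [this work] -/
@[simp] theorem mem_genUp {gens : Finset (Finset γ)} {t : Finset γ} : t ∈ genUp gens ↔ ∃ g ∈ gens, g ⊆ t := by
  simp [genUp]

omit [DecidableEq β] [Fintype β] in
/-- `genUp` is an up-set. [this work] -/
theorem isUpperSet_genUp (gens : Finset (Finset γ)) : IsUpperSet (genUp gens : Set (Finset γ)) := by
  intro t t' htt' ht
  rw [mem_coe, mem_genUp] at ht ⊢
  obtain ⟨g, hg, hgt⟩ := ht
  exact ⟨g, hg, hgt.trans htt'⟩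

omit [DecidableEq β] [Fintype β] in
/-- No generators: the empty family. [this work] -/
theorem genUp_empty : genUp (∅ : Finset (Finset γ)) = ∅ := by
  ext t; simp [genUp]

omit [DecidableEq β] [Fintype β] in
/-- The generators other than `g`, read inside the complement block of `g`. [this work] -/
theorem inCoblock_injOn {g : Finset γ} {rest : Finset (Finset γ)} (hrest : ∀ g' ∈ rest, Disjoint g g') :
    Set.InjOn (inCoblock g) (rest : Set (Finset γ)) := by
  intro g₁ h₁ g₂ h₂ heq
  ext a
  by_cases hag : a ∈ g
  · constructor
    · intro ha; exact absurd ha (disjoint_left.1 (hrest g₁ h₁) hag)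
    · intro ha; exact absurd ha (disjoint_left.1 (hrest g₂ h₂) hag)
  · have := congrArg (fun s : Finset {a // a ∉ g} => (⟨a, hag⟩ : {a // a ∉ g}) ∈ s) heq
    simpa [inCoblock] using this

omit [DecidableEq β] [Fintype β] in
/-- **Peeling identity**: for `g ∉ rest` with `g` disjoint from every member of `rest`,
`famMap (blockEquiv g) (genUp (insert g rest)) = orProd (upGen univ) (genUp (rest.image (inCoblock g)))`. [this work] -/
theorem famMap_genUp_cons {g : Finset γ} {rest : Finset (Finset γ)} (hrest : ∀ g' ∈ rest, Disjoint g g') :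
    famMap (blockEquiv g) (genUp (insert g rest))
      = orProd (upGen (univ : Finset {a // a ∈ g})) (genUp (rest.image (inCoblock g))) := by
  ext s
  rw [mem_famMap, mem_orProd, mem_genUp, mem_genUp]
  simp only [upGen, mem_filter, mem_univ, true_and, exists_mem_insert, mem_image]
  have hL : g ⊆ s.map (blockEquiv g).symm.toEmbedding ↔ univ ⊆ s.toLeft := by
    constructor
    · intro hsub x _
      rw [mem_toLeft]
      exact (inl_mem_iff x).1 (hsub x.2)
    · intro hsub a ha
      have := hsub (mem_univ ⟨a, ha⟩)
      rw [mem_toLeft] at this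
      exact (inl_mem_iff ⟨a, ha⟩).2 this
  have hR : ∀ g' ∈ rest, (g' ⊆ s.map (blockEquiv g).symm.toEmbedding ↔ inCoblock g g' ⊆ s.toRight) := by
    intro g' hg'
    constructor
    · intro hsub y hy
      simp only [inCoblock, mem_filter, mem_univ, true_and] at hy
      rw [mem_toRight]
      exact (inr_mem_iff y).1 (hsub hy)
    · intro hsub a ha
      have hag : a ∉ g := fun hag => disjoint_left.1 (hrest g' hg') hag ha
      have := hsub (show (⟨a, hag⟩ : {a // a ∉ g}) ∈ inCoblock g g' by simp [inCoblock, ha])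
      rw [mem_toRight] at this
      exact (inr_mem_iff ⟨a, hag⟩).2 this
  rw [hL]
  constructor
  · rintro (h | ⟨g', hg', hsub⟩)
    · exact Or.inl h
    · exact Or.inr ⟨inCoblock g g', ⟨g', hg', rfl⟩, (hR g' hg').1 hsub⟩
  · rintro (h | ⟨_, ⟨g', hg', rfl⟩, hsub⟩)
    · exact Or.inl h
    · exact Or.inr ⟨g', hg', (hR g' hg').2 hsub⟩

/-- **Pairwise disjoint nonempty generators give a Kleitman shell** (all finite ground types, by induction on the number of generators). [this work] -/
theorem klShell_genUp_disjoint_aux : ∀ (k : ℕ) {δ : Type} [DecidableEq δ] [Fintype δ] (gens : Finset (Finset δ)),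
    gens.card = k → (∀ g ∈ gens, g.Nonempty) → (∀ g₁ ∈ gens, ∀ g₂ ∈ gens, g₁ ≠ g₂ → Disjoint g₁ g₂) →
    KlShell (genUp gens ∪ refl (genUp gens)) := by
  intro k
  induction k with
  | zero =>
    intro δ _ _ gens hcard _ _
    rw [card_eq_zero] at hcard
    subst hcard
    rw [genUp_empty]
    have : refl (∅ : Finset (Finset δ)) = ∅ := Finset.map_empty _
    rw [this, union_empty]
    exact klShell_empty
  | succ k ih =>
    intro δ _ _ gens hcard hne hdis
    obtain ⟨g, hg⟩ : gens.Nonempty := card_pos.1 (by omega)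
    set rest := gens.erase g with hrest_def
    have hgens : gens = insert g rest := (insert_erase hg).symm
    have hg_not : g ∉ rest := notMem_erase g gens
    have hrest_sub : rest ⊆ gens := erase_subset g gens
    have hrest : ∀ g' ∈ rest, Disjoint g g' := fun g' hg' =>
      hdis g hg g' (hrest_sub hg') (fun h => hg_not (h ▸ hg'))
    -- the generators of the complement block
    set gens' : Finset (Finset {a // a ∉ g}) := rest.image (inCoblock g) with hgens'_def
    have hcard' : gens'.card = k := by
      rw [hgens'_def, card_image_of_injOn (inCoblock_injOn hrest), hrest_def, card_erase_of_mem hg, hcard]; rfl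
    have hne' : ∀ g' ∈ gens', g'.Nonempty := by
      intro g' hg'
      rw [hgens'_def, mem_image] at hg'
      obtain ⟨g₀, hg₀, rfl⟩ := hg'
      obtain ⟨a, ha⟩ := hne g₀ (hrest_sub hg₀)
      have hag : a ∉ g := fun hag => disjoint_left.1 (hrest g₀ hg₀) hag ha
      exact ⟨⟨a, hag⟩, by simp [inCoblock, ha]⟩
    have hdis' : ∀ g₁ ∈ gens', ∀ g₂ ∈ gens', g₁ ≠ g₂ → Disjoint g₁ g₂ := by
      intro g₁ h₁ g₂ h₂ hne12
      rw [hgens'_def, mem_image] at h₁ h₂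
      obtain ⟨a₁, ha₁, rfl⟩ := h₁
      obtain ⟨a₂, ha₂, rfl⟩ := h₂
      have hne' : a₁ ≠ a₂ := fun h => hne12 (h ▸ rfl)
      have hd := hdis a₁ (hrest_sub ha₁) a₂ (hrest_sub ha₂) hne'
      rw [disjoint_left] at hd ⊢
      intro y hy₁ hy₂
      simp only [inCoblock, mem_filter, mem_univ, true_and] at hy₁ hy₂
      exact hd hy₁ hy₂
    have hIH := ih gens' hcard' hne' hdis'
    have hu : (univ : Finset {a // a ∈ g}).Nonempty := by
      obtain ⟨a, ha⟩ := hne g hg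
      exact ⟨⟨a, ha⟩, mem_univ _⟩
    have hsh := klShell_orProd (klShell_upGen hu) hIH
    rw [← famMap_genUp_cons hrest, ← hgens, refl_famMap, ← famMap_union] at hsh
    have := klShell_famMap (blockEquiv g).symm hsh
    rwa [famMap_symm_famMap] at this

omit [DecidableEq β] [Fintype β] in
/-- **The shell of `↑g₁ ∪ … ∪ ↑g_k` for pairwise disjoint nonempty `g_i` is a Kleitman shell.** [this work] -/
theorem klShell_genUp_disjoint {gens : Finset (Finset γ)} (hne : ∀ g ∈ gens, g.Nonempty)
    (hdis : ∀ g₁ ∈ gens, ∀ g₂ ∈ gens, g₁ ≠ g₂ → Disjoint g₁ g₂) : KlShell (genUp gens ∪ refl (genUp gens)) :=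
  klShell_genUp_disjoint_aux gens.card gens rfl hne hdis

/-- **`TriWIneq` for read-once DNFs with disjoint terms**: pairwise disjoint nonempty generators ⟹ `0 ≤ triW (genUp gens) F G` for EVERY index cube and all
monotone families of up-sets (coordinates outside `⋃ gens` are free). [this work] -/
theorem triW_nonneg_genUp_disjoint {gens : Finset (Finset γ)} (hne : ∀ g ∈ gens, g.Nonempty)
    (hdis : ∀ g₁ ∈ gens, ∀ g₂ ∈ gens, g₁ ≠ g₂ → Disjoint g₁ g₂)
    (F G : Finset β → Finset (Finset γ))
    (hF : ∀ x, IsUpperSet (F x : Set (Finset γ))) (hG : ∀ x, IsUpperSet (G x : Set (Finset γ)))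
    (hFm : Monotone F) (hGm : Monotone G) :
    0 ≤ triW (genUp gens) F G :=
  triW_nonneg_of_shell (isUpperSet_genUp gens) (klShell_genUp_disjoint hne hdis) F G hF hG hFm hGm

end FiveUpSet

end Summit.CriticalPhenomena.PercolationContinuityZ3.Theorems
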